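import Mathlib
import HarnessLib
import Summits.NavierStokesRegularity.FluidComputer.TriggeredTransferViscosity
import Summits.NavierStokesRegularity.FluidComputer.TriggeredTransferRobustBounded

/-!
# Door N1-FC: the tolerance-robust and the bounded typings are viscosity-free too

Cell `ns-blowup`, seat `ns-blowup-fc-prover-2` g3 (D-0074 GROUP C «bridge support»; LADDER-NS rung N1-FC).
LABEL: E–C typing / calibration. WHAT THIS IS NOT: not Navier–Stokes evidence — the time dilation
`u ↦ κ·u(κt, x)` (Tao 2013, footnote 3) of `TriggeredTransferViscosity.lean` carried through the OPEN
predicates `StepWithin` / `TransfersWithin` / `TransfersWithBudget` (`TriggeredTransferRobust.lean`, the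
tolerance-robust twin a MODEL cell can witness), `StepB` / `TransfersB` (`TriggeredTransferBounded.lean`,
the bounded re-typing that closes (C) with zero named facts) and `StepWithinB` / `TransfersWithinB` /
`TransfersWithBudgetB` (`TriggeredTransferRobustBounded.lean`); implications and equivalences between
open predicates; no scheme instance, no transfer, no blow-up asserted.

* `piece_dilate`: the common core of every step (margin, transfer-time law, trigger, classical
  solution at viscosity `κν`, initial slice `κ • w`, energy `× κ²`) dilates — one proof for all typings;
* RELATIVE tolerances are dilation-invariant: `smul_mem_dilate_nbhd` / `exists_of_mem_dilate_nbhd`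
  (`κ • nbhd ρ U = (dilate κ).nbhd ρ (κU)`), `handover_within_dilate` (the hand-over clause
  `‖u T − zoom λ x₀ w'‖ ≤ ρ·λU'` becomes the same clause with `κ • w'`, `κU'`, the SAME `ρ`); sup-CEILINGS
  scale, `M ↦ κM` (`ceiling_dilate`);
* `StepWithin.dilate`, `StepWithinB.dilate`, `exists_link_dilate` / `StepB.dilate`;
  `TransfersWithin.dilate`, `TransfersWithBudget.dilate`, `TransfersWithinB.dilate`,
  `TransfersWithBudgetB.dilate`, `TransfersB.dilate` — all with the SAME tolerances / budget keys;
* the existential forms consumed by routes are viscosity-free: `exists_transfersWithin_iff_of_pos`,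
  `exists_transfersB_iff_of_pos`, `exists_transfersWithinB_iff_of_pos` — together with
  `exists_transfers_iff_of_pos` every typing of door N1-FC in the tree reads the same proposition at the
  DNS viscosity `ν₀` as at the route's unit viscosity.

References: T. Tao, Anal. PDE 6 (2013), footnote 3 [cite: Tao2011, footnote 3]; T. Tao, J. Amer. Math.
Soc. 29 (2016) §1.3 [cite: Tao2016AveragedNS, §1.3]. 0 sorry; no def; axioms ⊆ {propext, Classical.choice,
Quot.sound}.
-/

noncomputable section

namespace Summit.NavierStokesRegularity.FluidComputer.TriggeredTransfer

open Set MeasureTheory Function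
open scoped ENNReal ContDiff NNReal
open Literature.Analysis.FluidPDE
open Literature.Analysis.FluidPDE.FluidComputer (E3 Vel)
open Summit.NavierStokesRegularity.NavierStokesRegularity.Theorems (isClassicalNSSolutionOn_viscosityChange)
open Summit.NavierStokesRegularity.FluidComputer.PalasekTowerClayBridge (hasRapidSpatialDecay_const_smul)

namespace TriggerScheme

variable {𝒮 : TriggerScheme} {κ : ℝ}

/-! ## The common core of a step dilates -/

/-- **The piece of a step dilates** (Tao's footnote 3 with the force slot): margin `δ/κ`, hand-over
time `T/κ` obeying the SAME law `C_τ (1 + |log ε|)^q / (κU)`, trigger `κ²g(κt,x)` admissible for the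
dilated scheme, the classical solution `κu(κt,x)` at viscosity `κν` on `[0, T/κ + δ/κ]` from `κ • w`,
energy `× κ²`. [cite: Tao2011, footnote 3] -/
theorem piece_dilate (hκ : 0 < κ) {ν U ε T δ : ℝ} {w : Vel} {g u : ℝ → Vel} {p : ℝ → E3 → ℝ}
    (hδ : 0 < δ) (h2δ : 2 * δ < T) (hT : T ≤ 𝒮.Cτ * (1 + |Real.log ε|) ^ 𝒮.q / U)
    (hg : 𝒮.IsTrigger ε δ T g) (hsol : IsClassicalNSSolutionOn (Icc 0 (T + δ)) ν g u p)
    (hu0 : u 0 = w) (hE : ∃ C : ℝ≥0∞, C < ⊤ ∧ ∀ t ∈ Icc 0 (T + δ), ∫⁻ x, ‖u t x‖ₑ ^ 2 ≤ C) :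
    0 < δ / κ ∧ 2 * (δ / κ) < T / κ ∧
      T / κ ≤ (𝒮.dilate κ hκ).Cτ * (1 + |Real.log ε|) ^ (𝒮.dilate κ hκ).q / (κ * U) ∧
      (𝒮.dilate κ hκ).IsTrigger ε (δ / κ) (T / κ) (timeRescale κ (κ ^ 2) g) ∧
      IsClassicalNSSolutionOn (Icc 0 (T / κ + δ / κ)) (κ * ν) (timeRescale κ (κ ^ 2) g)
        (timeRescale κ κ u) (timeRescale κ (κ ^ 2) p) ∧
      timeRescale κ κ u 0 = κ • w ∧
      ∃ C : ℝ≥0∞, C < ⊤ ∧ ∀ t ∈ Icc 0 (T / κ + δ / κ), ∫⁻ x, ‖timeRescale κ κ u t x‖ₑ ^ 2 ≤ C := by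
  have hTδ : 0 < T + δ := by linarith
  have hsum : T / κ + δ / κ = (T + δ) / κ := (add_div T δ κ).symm
  have hmaps : MapsTo (fun s => κ * s) (Icc (0 : ℝ) ((T + δ) / κ)) (Icc 0 (T + δ)) := fun s hs =>
    ⟨mul_nonneg hκ.le hs.1, by
      have := mul_le_mul_of_nonneg_left hs.2 hκ.le
      rwa [mul_div_cancel₀ _ hκ.ne'] at this⟩
  obtain ⟨C, hC, hEb⟩ := hE
  refine ⟨div_pos hδ hκ, ?_, ?_, hg.dilate hκ, ?_, ?_, ?_⟩
  · rw [← mul_div_assoc]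
    exact div_lt_div_of_pos_right h2δ hκ
  · rw [dilate_Cτ, dilate_q]
    calc T / κ ≤ 𝒮.Cτ * (1 + |Real.log ε|) ^ 𝒮.q / U / κ := div_le_div_of_nonneg_right hT hκ.le
      _ = 𝒮.Cτ * (1 + |Real.log ε|) ^ 𝒮.q / (κ * U) := by rw [div_div, mul_comm U κ]
  · rw [hsum]
    exact isClassicalNSSolutionOn_viscosityChange hsol κ hmaps (uniqueDiffOn_Icc (div_pos hTδ hκ))
  · rw [timeRescale_zero, hu0]
    rfl
  · refine ⟨ENNReal.ofReal (κ ^ 2) * C, ENNReal.mul_lt_top ENNReal.ofReal_lt_top hC, fun t ht => ?_⟩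
    rw [hsum] at ht
    rw [timeRescale_slice, lintegral_enorm_sq_const_smul]
    exact mul_le_mul_right (hEb (κ * t) (hmaps ht)) _

/-- The EXACT hand-over clause dilates: `u T = λ-zoom of w'` gives
`κu(κ·) (T/κ) = λ-zoom of (κ • w')`. [folklore] -/
theorem handover_dilate (hκ : 0 < κ) {T : ℝ} {u : ℝ → Vel} {w' : Vel} {x₀ : E3}
    (hhand : u T = fun x => 𝒮.lam • w' (𝒮.lam • (x - x₀))) :
    timeRescale κ κ u (T / κ) = fun x => (𝒮.dilate κ hκ).lam • (κ • w') ((𝒮.dilate κ hκ).lam • (x - x₀)) := by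
  funext x
  rw [timeRescale_apply, mul_div_cancel₀ _ hκ.ne', hhand, dilate_lam, Pi.smul_apply, smul_comm]

/-- The TOLERANT hand-over clause dilates with the SAME relative tolerance:
`‖u T − zoom λ x₀ w'‖ ≤ ρ·λU'` gives `‖κu(κ·)(T/κ) − zoom λ x₀ (κ • w')‖ ≤ ρ·λ(κU')`. [folklore] -/
theorem handover_within_dilate (hκ : 0 < κ) {T ρ U' : ℝ} {u : ℝ → Vel} {w' : Vel} {x₀ : E3}
    (hclose : ∀ x, ‖u T x - zoom 𝒮.lam x₀ w' x‖ ≤ ρ * (𝒮.lam * U')) (x : E3) :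
    ‖timeRescale κ κ u (T / κ) x - zoom (𝒮.dilate κ hκ).lam x₀ (κ • w') x‖ ≤
      ρ * ((𝒮.dilate κ hκ).lam * (κ * U')) := by
  rw [timeRescale_apply, mul_div_cancel₀ _ hκ.ne', dilate_lam, zoom_apply, Pi.smul_apply,
    smul_comm 𝒮.lam κ, ← zoom_apply, ← smul_sub, norm_smul, Real.norm_of_nonneg hκ.le]
  calc κ * ‖u T x - zoom 𝒮.lam x₀ w' x‖ ≤ κ * (ρ * (𝒮.lam * U')) :=
        mul_le_mul_of_nonneg_left (hclose x) hκ.le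
    _ = ρ * (𝒮.lam * (κ * U')) := by ring

/-- Rapid decay of the hand-over slice dilates (it is a constant multiple of a smooth rapidly
decaying slice). [folklore] -/
theorem decay_dilate {T : ℝ} {u : ℝ → Vel} (hdec : HasRapidSpatialDecay (u T))
    (hsm : ContDiff ℝ ∞ (u T)) (hκ : κ ≠ 0) :
    HasRapidSpatialDecay (timeRescale κ κ u (T / κ)) := by
  rw [timeRescale_slice, mul_div_cancel₀ _ hκ]
  exact hasRapidSpatialDecay_const_smul hdec hsm κ

/-- Sup-ceilings dilate: `‖u‖ ≤ M` on `[0, T + δ]` gives `‖κu(κ·)‖ ≤ κM` on `[0, T/κ + δ/κ]`.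
[folklore] -/
theorem ceiling_dilate (hκ : 0 < κ) {T δ M : ℝ} {u : ℝ → Vel}
    (hM : ∀ t ∈ Icc 0 (T + δ), ∀ x, ‖u t x‖ ≤ M) :
    ∀ t ∈ Icc 0 (T / κ + δ / κ), ∀ x, ‖timeRescale κ κ u t x‖ ≤ κ * M := by
  intro t ht x
  rw [← add_div] at ht
  have hκt : κ * t ∈ Icc 0 (T + δ) :=
    ⟨mul_nonneg hκ.le ht.1, by
      have := mul_le_mul_of_nonneg_left ht.2 hκ.le
      rwa [mul_div_cancel₀ _ hκ.ne'] at this⟩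
  rw [timeRescale_apply, norm_smul, Real.norm_of_nonneg hκ.le]
  exact mul_le_mul_of_nonneg_left (hM _ hκt x) hκ.le

/-! ## Relative neighbourhoods are dilation-invariant -/

/-- `κ •` a member of the `ρ`-neighbourhood at amplitude `U` is a member of the dilated scheme's
`ρ`-neighbourhood at amplitude `κU` (SAME relative tolerance). [folklore] -/
theorem smul_mem_dilate_nbhd (hκ : 0 < κ) {ρ U : ℝ} {v : Vel} (hv : v ∈ 𝒮.nbhd ρ U) :
    κ • v ∈ (𝒮.dilate κ hκ).nbhd ρ (κ * U) := by
  obtain ⟨⟨h1, h2, h3⟩, w, hw, hclose⟩ := hv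
  refine ⟨⟨h1.const_smul κ, VectorCalculus.IsDivFree.const_smul (h1.differentiable (by simp)) h2 κ,
    hasRapidSpatialDecay_const_smul h3 h1 κ⟩, κ • w, 𝒮.smul_mem_dilate_F κ hκ hw, fun x => ?_⟩
  rw [Pi.smul_apply, Pi.smul_apply, ← smul_sub, norm_smul, Real.norm_of_nonneg hκ.le, mul_left_comm]
  exact mul_le_mul_of_nonneg_left (hclose x) hκ.le

/-- Every member of the dilated scheme's `ρ`-neighbourhood at amplitude `V` is `κ •` a member of the
original `ρ`-neighbourhood at amplitude `V/κ`. [folklore] -/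
theorem exists_of_mem_dilate_nbhd (hκ : 0 < κ) {ρ V : ℝ} {v' : Vel}
    (hv' : v' ∈ (𝒮.dilate κ hκ).nbhd ρ V) : ∃ v ∈ 𝒮.nbhd ρ (V / κ), v' = κ • v := by
  obtain ⟨⟨h1, h2, h3⟩, w', hw', hclose⟩ := hv'
  rw [dilate_F] at hw'
  obtain ⟨w, hw, rfl⟩ := hw'
  refine ⟨κ⁻¹ • v', ⟨⟨h1.const_smul κ⁻¹,
    VectorCalculus.IsDivFree.const_smul (h1.differentiable (by simp)) h2 κ⁻¹,
    hasRapidSpatialDecay_const_smul h3 h1 κ⁻¹⟩, w, hw, fun x => ?_⟩, ?_⟩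
  · have hx : ‖v' x - κ • w x‖ ≤ ρ * V := hclose x
    have key : κ⁻¹ • v' x - w x = κ⁻¹ • (v' x - κ • w x) := by
      rw [smul_sub, smul_smul, inv_mul_cancel₀ hκ.ne', one_smul]
    rw [Pi.smul_apply, key, norm_smul, norm_inv, Real.norm_of_nonneg hκ.le]
    calc κ⁻¹ * ‖v' x - κ • w x‖ ≤ κ⁻¹ * (ρ * V) := mul_le_mul_of_nonneg_left hx (inv_nonneg.2 hκ.le)
      _ = ρ * (V / κ) := by rw [div_eq_mul_inv]; ring
  · funext x
    rw [Pi.smul_apply, Pi.smul_apply, smul_smul, mul_inv_cancel₀ hκ.ne', one_smul]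

/-! ## The tolerant and the bounded steps dilate -/

/-- **Tolerant steps dilate** with the SAME hand-over tolerance. [cite: Tao2011, footnote 3] -/
theorem StepWithin.dilate (hκ : 0 < κ) {ν U ε ρ : ℝ} {w : Vel} (h : 𝒮.StepWithin ν U ε w ρ) :
    (𝒮.dilate κ hκ).StepWithin (κ * ν) (κ * U) ε (κ • w) ρ := by
  obtain ⟨T, δ, g, u, p, hδ, h2δ, hT, hg, hsol, hu0, hE, hdec, U', w', x₀, hgrow, hw', hx₀, hclose⟩ :=
    h
  have hTmem : T ∈ Icc 0 (T + δ) := ⟨by linarith, by linarith⟩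
  obtain ⟨h1, h2, h3, h4, h5, h6, h7⟩ := piece_dilate hκ hδ h2δ hT hg hsol hu0 hE
  refine ⟨T / κ, δ / κ, _, _, _, h1, h2, h3, h4, h5, h6, h7,
    decay_dilate hdec (hsol.contDiff_velocity hTmem) hκ.ne', κ * U', κ • w', x₀, ?_,
    𝒮.smul_mem_dilate_F κ hκ hw', hx₀, handover_within_dilate hκ hclose⟩
  rw [dilate_growth, mul_left_comm]
  exact mul_le_mul_of_nonneg_left hgrow hκ.le

/-- **Tolerant bounded steps dilate** (same tolerance, ceiling `× κ`). [cite: Tao2011, footnote 3] -/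
theorem StepWithinB.dilate (hκ : 0 < κ) {ν U ε ρ : ℝ} {w : Vel} (h : 𝒮.StepWithinB ν U ε w ρ) :
    (𝒮.dilate κ hκ).StepWithinB (κ * ν) (κ * U) ε (κ • w) ρ := by
  obtain ⟨T, δ, g, u, p, hδ, h2δ, hT, hg, hsol, hu0, hE, hdec, ⟨M, hM⟩, U', w', x₀, hgrow, hw', hx₀,
    hclose⟩ := h
  have hTmem : T ∈ Icc 0 (T + δ) := ⟨by linarith, by linarith⟩
  obtain ⟨h1, h2, h3, h4, h5, h6, h7⟩ := piece_dilate hκ hδ h2δ hT hg hsol hu0 hE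
  refine ⟨T / κ, δ / κ, _, _, _, h1, h2, h3, h4, h5, h6, h7,
    decay_dilate hdec (hsol.contDiff_velocity hTmem) hκ.ne', ⟨κ * M, ceiling_dilate hκ hM⟩,
    κ * U', κ • w', x₀, ?_, 𝒮.smul_mem_dilate_F κ hκ hw', hx₀, handover_within_dilate hκ hclose⟩
  rw [dilate_growth, mul_left_comm]
  exact mul_le_mul_of_nonneg_left hgrow hκ.le

/-- **Links dilate**: from a witness `L` of `Step ν U ε w` a witness of the dilated step whose piece
IS `κ·L.u(κt,x)` on `[0, L.T/κ + L.δ/κ]` (needed to carry ceilings). [cite: Tao2011, footnote 3] -/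
theorem exists_link_dilate (hκ : 0 < κ) {ν U ε : ℝ} {w : Vel} (L : 𝒮.Link ν U ε w) :
    ∃ L' : (𝒮.dilate κ hκ).Link (κ * ν) (κ * U) ε (κ • w),
      L'.T = L.T / κ ∧ L'.δ = L.δ / κ ∧ L'.u = timeRescale κ κ L.u := by
  obtain ⟨h1, h2, h3, h4, h5, h6, h7⟩ :=
    piece_dilate hκ L.δ_pos L.two_δ_lt L.T_le L.trigger L.classical L.initial L.energy
  have hgrow : (𝒮.dilate κ hκ).growth * (κ * U) ≤ κ * L.U' := by
    rw [dilate_growth, mul_left_comm]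
    exact mul_le_mul_of_nonneg_left L.growth_le hκ.le
  exact ⟨⟨L.T / κ, L.δ / κ, _, _, _, κ * L.U', κ • L.w', L.x₀, h1, h2, h3, h4, h5, h6, h7, hgrow,
    𝒮.smul_mem_dilate_F κ hκ L.mem, L.norm_x₀_le, handover_dilate hκ L.handover⟩, rfl, rfl, rfl⟩

/-- **Bounded steps dilate** (ceiling `× κ`). [cite: Tao2011, footnote 3] -/
theorem StepB.dilate (hκ : 0 < κ) {ν U ε : ℝ} {w : Vel} (h : 𝒮.StepB ν U ε w) :
    (𝒮.dilate κ hκ).StepB (κ * ν) (κ * U) ε (κ • w) := by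
  obtain ⟨L, M, hM⟩ := h
  obtain ⟨L', hT, hδ, hu⟩ := exists_link_dilate hκ L
  refine ⟨L', κ * M, ?_⟩
  rw [hT, hδ, hu]
  exact ceiling_dilate hκ hM

/-! ## The transfer predicates dilate, with the same tolerances and budget keys -/

/-- The admissibility clause read backwards through the dilation: `κν |log ε| ≤ a V` is
`ν |log ε| ≤ a (V/κ)`. [folklore] -/
theorem admissible_div (hκ : 0 < κ) {ν ε V : ℝ} (hadm : κ * ν * |Real.log ε| ≤ 𝒮.a * V) :
    ν * |Real.log ε| ≤ 𝒮.a * (V / κ) := by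
  rw [← mul_div_assoc, le_div_iff₀ hκ]
  calc ν * |Real.log ε| * κ = κ * ν * |Real.log ε| := by ring
    _ ≤ 𝒮.a * V := hadm

/-- **Robust transfer dilates** with the SAME tolerances `(ρin, ρout)`. [cite: Tao2011, footnote 3] -/
theorem TransfersWithin.dilate (hκ : 0 < κ) {ν ρin ρout : ℝ} (h : 𝒮.TransfersWithin ν ρin ρout) :
    (𝒮.dilate κ hκ).TransfersWithin (κ * ν) ρin ρout := by
  intro V hV v' hv' ε hε hε1 hadm
  rw [dilate_UStar] at hV
  rw [dilate_a] at hadm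
  have hVκ : 𝒮.UStar ≤ V / κ := by rwa [le_div_iff₀ hκ, mul_comm]
  obtain ⟨v, hv, rfl⟩ := exists_of_mem_dilate_nbhd hκ hv'
  have hstep := (h (V / κ) hVκ v hv ε hε hε1 (admissible_div hκ hadm)).dilate hκ
  rwa [mul_div_cancel₀ _ hκ.ne'] at hstep

/-- **Robust bounded transfer dilates** with the SAME tolerances. [cite: Tao2011, footnote 3] -/
theorem TransfersWithinB.dilate (hκ : 0 < κ) {ν ρin ρout : ℝ} (h : 𝒮.TransfersWithinB ν ρin ρout) :
    (𝒮.dilate κ hκ).TransfersWithinB (κ * ν) ρin ρout := by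
  intro V hV v' hv' ε hε hε1 hadm
  rw [dilate_UStar] at hV
  rw [dilate_a] at hadm
  have hVκ : 𝒮.UStar ≤ V / κ := by rwa [le_div_iff₀ hκ, mul_comm]
  obtain ⟨v, hv, rfl⟩ := exists_of_mem_dilate_nbhd hκ hv'
  have hstep := (h (V / κ) hVκ v hv ε hε hε1 (admissible_div hκ hadm)).dilate hκ
  rwa [mul_div_cancel₀ _ hκ.ne'] at hstep

/-- **Affine error budgets dilate** with the SAME keys `(amp, leak)` (relative sup-norm units; the
floor constant `c` is unchanged). [cite: Tao2011, footnote 3] -/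
theorem TransfersWithBudget.dilate (hκ : 0 < κ) {ν amp leak : ℝ} (h : 𝒮.TransfersWithBudget ν amp leak) :
    (𝒮.dilate κ hκ).TransfersWithBudget (κ * ν) amp leak :=
  fun ρ hρ hρc => (h ρ hρ hρc).dilate hκ

/-- **Affine error budgets with ceilings dilate** with the SAME keys. [cite: Tao2011, footnote 3] -/
theorem TransfersWithBudgetB.dilate (hκ : 0 < κ) {ν amp leak : ℝ}
    (h : 𝒮.TransfersWithBudgetB ν amp leak) :
    (𝒮.dilate κ hκ).TransfersWithBudgetB (κ * ν) amp leak :=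
  fun ρ hρ hρc => (h ρ hρ hρc).dilate hκ

/-- **Bounded transfer dilates.** [cite: Tao2011, footnote 3] -/
theorem TransfersB.dilate (hκ : 0 < κ) {ν : ℝ} (h : 𝒮.TransfersB ν) :
    (𝒮.dilate κ hκ).TransfersB (κ * ν) := by
  rintro V hV v ⟨w, hw, rfl⟩ ε hε hε1 hadm
  rw [dilate_UStar] at hV
  rw [dilate_a] at hadm
  have hVκ : 𝒮.UStar ≤ V / κ := by rwa [le_div_iff₀ hκ, mul_comm]
  have hstep := (h (V / κ) hVκ w hw ε hε hε1 (admissible_div hκ hadm)).dilate hκ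
  rwa [mul_div_cancel₀ _ hκ.ne'] at hstep

/-! ## Every typing of the door is viscosity-free -/

/-- **Robust door, one viscosity gives all** (tolerances below the floor constant are preserved since
`c` is). [cite: Tao2011, footnote 3] -/
theorem exists_transfersWithin_of_pos {ν ν' : ℝ} (hν : 0 < ν) (hν' : 0 < ν')
    (h : ∃ (𝒮 : TriggerScheme) (ρin ρout : ℝ),
      0 ≤ ρout ∧ ρout ≤ ρin ∧ ρin < 𝒮.c ∧ 𝒮.TransfersWithin ν ρin ρout) :
    ∃ (𝒮 : TriggerScheme) (ρin ρout : ℝ),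
      0 ≤ ρout ∧ ρout ≤ ρin ∧ ρin < 𝒮.c ∧ 𝒮.TransfersWithin ν' ρin ρout := by
  obtain ⟨𝒮, ρin, ρout, h0, hio, hρc, hT⟩ := h
  have hκ : 0 < ν' / ν := div_pos hν' hν
  refine ⟨𝒮.dilate (ν' / ν) hκ, ρin, ρout, h0, hio, by rwa [dilate_c], ?_⟩
  have := hT.dilate hκ
  rwa [div_mul_cancel₀ ν' hν.ne'] at this

/-- **Viscosity is not a parameter of the robust door**: for all `ν, ν' > 0` the existence of a
robustly transferring scheme (tolerances `0 ≤ ρout ≤ ρin < c`) at `ν` is equivalent to the same at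
`ν'`. [cite: Tao2011, footnote 3] -/
theorem exists_transfersWithin_iff_of_pos {ν ν' : ℝ} (hν : 0 < ν) (hν' : 0 < ν') :
    (∃ (𝒮 : TriggerScheme) (ρin ρout : ℝ),
        0 ≤ ρout ∧ ρout ≤ ρin ∧ ρin < 𝒮.c ∧ 𝒮.TransfersWithin ν ρin ρout) ↔
      ∃ (𝒮 : TriggerScheme) (ρin ρout : ℝ),
        0 ≤ ρout ∧ ρout ≤ ρin ∧ ρin < 𝒮.c ∧ 𝒮.TransfersWithin ν' ρin ρout :=
  ⟨exists_transfersWithin_of_pos hν hν', exists_transfersWithin_of_pos hν' hν⟩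

/-- **Bounded door, one viscosity gives all.** [cite: Tao2011, footnote 3] -/
theorem exists_transfersB_of_pos {ν ν' : ℝ} (hν : 0 < ν) (hν' : 0 < ν')
    (h : ∃ 𝒮 : TriggerScheme, 𝒮.TransfersB ν) : ∃ 𝒮 : TriggerScheme, 𝒮.TransfersB ν' := by
  obtain ⟨𝒮, hT⟩ := h
  refine ⟨𝒮.dilate (ν' / ν) (div_pos hν' hν), ?_⟩
  have := hT.dilate (div_pos hν' hν)
  rwa [div_mul_cancel₀ ν' hν.ne'] at this

/-- **Viscosity is not a parameter of the bounded door**: `(∃ 𝒮, 𝒮.TransfersB ν) ↔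
(∃ 𝒮, 𝒮.TransfersB ν')` for all `ν, ν' > 0` — so the zero-named-fact closer
`navierStokesBreakdownR3_of_exists_transfersB` (unit viscosity) reads the hypothesis at any DNS
viscosity. [cite: Tao2011, footnote 3] -/
theorem exists_transfersB_iff_of_pos {ν ν' : ℝ} (hν : 0 < ν) (hν' : 0 < ν') :
    (∃ 𝒮 : TriggerScheme, 𝒮.TransfersB ν) ↔ ∃ 𝒮 : TriggerScheme, 𝒮.TransfersB ν' :=
  ⟨exists_transfersB_of_pos hν hν', exists_transfersB_of_pos hν' hν⟩

/-- **Robust bounded door, one viscosity gives all.** [cite: Tao2011, footnote 3] -/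
theorem exists_transfersWithinB_of_pos {ν ν' : ℝ} (hν : 0 < ν) (hν' : 0 < ν')
    (h : ∃ (𝒮 : TriggerScheme) (ρin ρout : ℝ),
      0 ≤ ρout ∧ ρout ≤ ρin ∧ ρin < 𝒮.c ∧ 𝒮.TransfersWithinB ν ρin ρout) :
    ∃ (𝒮 : TriggerScheme) (ρin ρout : ℝ),
      0 ≤ ρout ∧ ρout ≤ ρin ∧ ρin < 𝒮.c ∧ 𝒮.TransfersWithinB ν' ρin ρout := by
  obtain ⟨𝒮, ρin, ρout, h0, hio, hρc, hT⟩ := h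
  have hκ : 0 < ν' / ν := div_pos hν' hν
  refine ⟨𝒮.dilate (ν' / ν) hκ, ρin, ρout, h0, hio, by rwa [dilate_c], ?_⟩
  have := hT.dilate hκ
  rwa [div_mul_cancel₀ ν' hν.ne'] at this

/-- **Viscosity is not a parameter of the robust bounded door.** [cite: Tao2011, footnote 3] -/
theorem exists_transfersWithinB_iff_of_pos {ν ν' : ℝ} (hν : 0 < ν) (hν' : 0 < ν') :
    (∃ (𝒮 : TriggerScheme) (ρin ρout : ℝ),
        0 ≤ ρout ∧ ρout ≤ ρin ∧ ρin < 𝒮.c ∧ 𝒮.TransfersWithinB ν ρin ρout) ↔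
      ∃ (𝒮 : TriggerScheme) (ρin ρout : ℝ),
        0 ≤ ρout ∧ ρout ≤ ρin ∧ ρin < 𝒮.c ∧ 𝒮.TransfersWithinB ν' ρin ρout :=
  ⟨exists_transfersWithinB_of_pos hν hν', exists_transfersWithinB_of_pos hν' hν⟩

/-- **(C) from the bounded door at ANY viscosity, zero named facts**: a scheme transferring with
ceilings at some `ν > 0` gives `NavierStokesBreakdownR3` (the bounded door is viscosity-free and closes
at unit viscosity by `navierStokesBreakdownR3_of_exists_transfersB`, PATH B′). [cite: FeffermanClay2006, (C)] -/
theorem navierStokesBreakdownR3_of_exists_transfersB_at {ν : ℝ} (hν : 0 < ν)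
    (h : ∃ 𝒮 : TriggerScheme, 𝒮.TransfersB ν) :
    Summit.NavierStokesRegularity.NavierStokesRegularity.NavierStokesBreakdownR3 :=
  navierStokesBreakdownR3_of_exists_transfersB (exists_transfersB_of_pos hν one_pos h)

end TriggerScheme

end Summit.NavierStokesRegularity.FluidComputer.TriggeredTransfer

end
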